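import Summits.NavierStokesRegularity.FluidComputer.PalasekTowerStrainShadowedRunSharp
import Summits.NavierStokesRegularity.NavierStokesRegularity.Theorems.PalasekTowerBreakdownEpisodeBaseShadowedRun

/-!
# `EpisodeBase` from a line-germ design and a STRAIN-CERTIFIED pseudo-run — NUMERAL version (slice constant 9.03)

Cell `ns-blowup`, seat `ns-blowup-fc-prover-3` (g10); `--supports stmt-NavierStokesRegularity-19179`
(crux `EpisodeBase` of `route-NavierStokesRegularity-PalasekTowerBreakdown`; line `straindoor` of
cstrat-19179, the analysis stub `stub_strain_door` in ROUTE (A): `L²` strain Grönwall + `L² → L^∞`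
smoothing; closes nothing by itself). LABEL: E–C typing (theorems only; no definition, no named fact,
no `sorry`). WHAT THIS IS NOT: not Navier–Stokes evidence — a conditional constructor of the crux from a
GIVEN design `d : LineGermData U ρ σ₀ ε₀ c₄` and a GIVEN forced reference run with certified defect,
strain majorant and readouts; no such pair is exhibited; no verdict on 19179.

**`palasekTowerBreakdown_episodeBase_of_lineGerm_strainShadowedRun_sharp`.** Twin of p527727 with every
`oseenSliceConst ℝ³` replaced by the explicit slice constant `9.03` (fc-prover-2, `OseenSliceConstUpperBound`), so
that ALL thresholds are numerals a certificate can evaluate. Data, on the SHIFTED window clock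
`[0, w₀]` (`w₀ = Host.wfirst`, `Host.τfirst = 1 + w₀`), unit viscosity: a classical reference `(w, ϖ)`
forced by `g` (jointly continuous, bounded, weakly divergence free, `‖g(t)‖₂ ≤ G₂`), finite energy, Tao
`L²`-Sobolev class, `‖w‖ ≤ B_w`, strain majorant `−⟪ξ, Dw(t,x)ξ⟫ ≤ Γ(t)‖ξ‖²` (`Γ ≥ 0` continuous);
gaps to the germ datum `‖w(0) − U‖_∞ ≤ D`, `∫‖U − w(0)‖² ≤ E₀²`; a window `h` with
`(24·9.03·(2B_w+1))² h ≤ 1`; a tolerance `δ ≤ 1/2` with `2(D + 4h^{1/4}G₂)e^{36·9.03²(2B_w+1)²h} ≤ δ` and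
`2((E₀ + G₂ w₀)e^{∫₀^{w₀} Γ} + 4G₂h)h^{-3/4} ≤ δ` — THE FEE IS `e^{∫Γ}`, STRAIN TIMES —; a margin `η > 0`;
and the four EXPLICIT readouts of `w`: cap `≤ (5/3)Y₁ − η − δ` on the window, speed `≥ Y₁ + η + δ` at
some `‖x‖ ≤ ρ` at time `w₀`, finite-difference strain `(A₁+η)‖x₁−x₀‖ + 2δ < ‖w(w₀,x₁) − w(w₀,x₀)‖`, core
circulation `≥ N₁^{β−2} + η + δ·8π/N₁`. CONCLUSION: `PalasekTowerBreakdown.EpisodeBase`. Proof: the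
numeral strain-shadowed run (`StrainShadowSharp.exists_freeRun_near_of_strain`) gives the exact free run from `U`,
`δ`-close to `w` on `[0, w₀]`; shifted back to `[1, τfirst]` it enters the currency-free letter
`palasekTowerBreakdown_episodeBase_of_lineGerm_nearFreeRun` (p515004).
[cite: Palasek2026ElementaryModel, §4] [cite: DashtiRobinson2008, Thm. 5] [cite: Tao2011, Thm. 5.4 (ii)+(iv)]
-/

noncomputable section

set_option linter.dupNamespace false

namespace Summit.NavierStokesRegularity.NavierStokesRegularity.Theorems

open Set MeasureTheory Metric Function InnerProductSpace
open scoped ENNReal NNReal ContDiff RealInnerProductSpace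
open Summit.NavierStokesRegularity.NavierStokesRegularity.Theses
open Summit.NavierStokesRegularity.FluidComputer.PalasekTowerClayBridge
open Summit.NavierStokesRegularity.FluidComputer.PalasekTowerClayBridge.Germ
open Literature.Analysis Literature.Analysis.FluidPDE

/-- **`EpisodeBase` from a line-germ design and a strain-certified pseudo-run on the shifted window
clock** (see the module docstring for the data; the exponential fee of the certificate is `e^{∫₀^{w₀} Γ}`,
`Γ` the maximal compression rate of the reference). [cite: Palasek2026ElementaryModel, §4]
[cite: DashtiRobinson2008, Thm. 5] [cite: Tao2011, Thm. 5.4 (ii)+(iv)] -/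
theorem palasekTowerBreakdown_episodeBase_of_lineGerm_strainShadowedRun_sharp
    {U : EuclideanSpace ℝ (Fin 3) → EuclideanSpace ℝ (Fin 3)} {ρ σ₀ ε₀ c₄ : ℝ} (d : LineGermData U ρ σ₀ ε₀ c₄)
    {w g : ℝ → EuclideanSpace ℝ (Fin 3) → EuclideanSpace ℝ (Fin 3)} {ϖ : ℝ → EuclideanSpace ℝ (Fin 3) → ℝ}
    {Γ : ℝ → ℝ} {Bw Gb G₂r D E₀ h δ η : ℝ}
    (hw : IsClassicalNSSolutionOn (Icc 0 Host.wfirst) 1 g w ϖ)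
    (hgc : Continuous (uncurry g)) (hGb : ∀ τ ∈ Icc 0 Host.wfirst, ∀ y, ‖g τ y‖ ≤ Gb)
    (hgdiv : ∀ τ ∈ Icc 0 Host.wfirst, IsWeaklyDivFree (g τ)) (hG₂r : 0 ≤ G₂r)
    (hg2 : ∀ τ ∈ Icc 0 Host.wfirst, eLpNorm (g τ) 2 volume ≤ ENNReal.ofReal G₂r)
    (hEw : ∃ C : ℝ≥0∞, C < ⊤ ∧ ∀ t ∈ Icc 0 Host.wfirst, ∫⁻ x, ‖w t x‖ₑ ^ 2 ≤ C)
    (hwS : HasBoundedSobolevNormsOn (Icc 0 Host.wfirst) w)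
    (hwt : HasBoundedSobolevNormsOn (Icc 0 Host.wfirst) (FluidPDE.timeDerivWithin (Icc 0 Host.wfirst) w))
    (hϖS : ∀ n : ℕ, ∃ C' : ℝ≥0, ∀ t ∈ Icc 0 Host.wfirst, ∫⁻ x, ‖iteratedFDeriv ℝ n (ϖ t) x‖ₑ ^ 2 ≤ C')
    (hBw : 0 < Bw) (hbw : ∀ t ∈ Icc 0 Host.wfirst, ∀ y, ‖w t y‖ ≤ Bw)
    (hΓc : ContinuousOn Γ (Icc 0 Host.wfirst)) (hΓ0 : ∀ t ∈ Icc 0 Host.wfirst, 0 ≤ Γ t)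
    (hΓ : ∀ t ∈ Icc 0 Host.wfirst, ∀ x ξ, -⟪ξ, fderiv ℝ (w t) x ξ⟫ ≤ Γ t * ‖ξ‖ ^ 2)
    (hD : ∀ y, ‖w 0 y - U y‖ ≤ D) (hE₀ : 0 ≤ E₀) (hE0 : ∫ x, ‖U x - w 0 x‖ ^ 2 ≤ E₀ ^ 2)
    (hh : 0 < h) (hTs : (24 * (9.03 : ℝ) * (Bw + 1 + Bw)) ^ 2 * h ≤ 1)
    (hδ : δ ≤ 1 / 2)
    (hδ₁ : 2 * (D + 4 * h ^ (1 / 4 : ℝ) * G₂r) *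
      Real.exp (36 * (9.03 : ℝ) ^ 2 * (Bw + 1 + Bw) ^ 2 * h) ≤ δ)
    (hδ₂ : 2 * ((E₀ + G₂r * Host.wfirst) * Real.exp (∫ s in (0 : ℝ)..Host.wfirst, Γ s) + 4 * G₂r * h) *
      h ^ (-(3 / 4 : ℝ)) ≤ δ)
    (hη : 0 < η) (hwc : Continuous (w Host.wfirst))
    (hcap : ∀ t ∈ Icc 0 Host.wfirst, ∀ x, ‖w t x‖ ≤ 5 / 3 * TowerRates.wide.Y 1 - η - δ)
    (hspeed : ∃ x, ‖x‖ ≤ ρ ∧ TowerRates.wide.Y 1 + η + δ ≤ ‖w Host.wfirst x‖)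
    (hstrain : ∃ x₀ x₁, ‖x₀‖ ≤ ρ ∧ ‖x₁‖ ≤ ρ ∧
      (TowerRates.wide.A 1 + η) * ‖x₁ - x₀‖ + 2 * δ < ‖w Host.wfirst x₁ - w Host.wfirst x₀‖)
    (hcore : ∃ (x : EuclideanSpace ℝ (Fin 3)) (γ : ℝ → EuclideanSpace ℝ (Fin 3)),
      ‖x‖ ≤ ρ ∧ ContDiff ℝ 1 γ ∧ γ 0 = γ 1 ∧
      (∀ s ∈ Icc (0 : ℝ) 1, γ s ∈ closedBall x (1 / TowerRates.wide.N 1)) ∧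
      (∀ s ∈ Icc (0 : ℝ) 1, ‖deriv γ s‖ ≤ 8 * Real.pi / TowerRates.wide.N 1) ∧
      TowerRates.wide.N 1 ^ (TowerRates.wide.β - 2) + η + δ * (8 * Real.pi / TowerRates.wide.N 1) ≤
        circulation (w Host.wfirst) γ) :
    PalasekTowerBreakdown.EpisodeBase := by
  set W : ℝ := Host.wfirst with hW_def
  have hW : 0 < W := Host.wfirst_pos
  have hτ : Host.τfirst = 1 + W := Host.τfirst_eq
  -- the datum is a Clay datum
  have hUc : HasCompactSupport U :=
    IsCompact.of_isClosed_subset (isCompact_closedBall (0 : EuclideanSpace ℝ (Fin 3)) ρ)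
      (isClosed_tsupport U) d.support
  -- ### the strain-shadowed run on the shifted clock `[0, W]`
  obtain ⟨v', q', hv', hv'0, hv'E, hnear'⟩ :=
    StrainShadowSharp.exists_freeRun_near_of_strain hW hw hgc hGb hgdiv hG₂r hg2 hEw hwS hwt hϖS hBw hbw hΓc hΓ0
      hΓ d.smooth hUc d.divFree hD hE₀ hE0 hh hTs hδ hδ₁ hδ₂
  -- ### shift back to the register clock `[1, τfirst]`
  have hmem : ∀ {t : ℝ}, t ∈ Icc (1 : ℝ) Host.τfirst → t + -1 ∈ Icc 0 W := fun ht =>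
    ⟨by linarith [ht.1], by rw [hτ] at ht; linarith [ht.2]⟩
  have hτ1 : Host.τfirst + -1 = W := by rw [hτ]; ring
  have hv : IsClassicalNSSolutionOn (Icc 1 Host.τfirst) 1 0 (fun t => v' (t + -1)) (fun t => q' (t + -1)) := by
    have h := (hv'.comp_add_right (-1)).mono (fun t ht => hmem ht)
      (uniqueDiffOn_Icc (by rw [hτ]; linarith))
    have hz : (fun t : ℝ => (0 : ℝ → EuclideanSpace ℝ (Fin 3) → EuclideanSpace ℝ (Fin 3)) (t + -1)) = 0 := by
      funext t; rfl
    rw [hz] at h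
    exact h
  have hv1 : (fun t : ℝ => v' (t + -1)) 1 = U := by
    show v' (1 + -1) = U
    norm_num
    exact hv'0
  have hvE : ∃ C : ℝ≥0∞, C < ⊤ ∧ ∀ t ∈ Icc (1 : ℝ) Host.τfirst, ∫⁻ x, ‖(fun t => v' (t + -1)) t x‖ₑ ^ 2 ≤ C := by
    obtain ⟨C, hC, hb⟩ := hv'E
    exact ⟨C, hC, fun t ht => hb (t + -1) (hmem ht)⟩
  have hnear : ∀ t ∈ Icc (1 : ℝ) Host.τfirst, ∀ x,
      ‖(fun t => v' (t + -1)) t x - (fun t => w (t + -1)) t x‖ ≤ δ := fun t ht x =>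
    hnear' (t + -1) (hmem ht) x
  have hwc' : Continuous ((fun t : ℝ => w (t + -1)) Host.τfirst) := by
    show Continuous (w (Host.τfirst + -1))
    rw [hτ1]; exact hwc
  have hcap' : ∀ t ∈ Icc (1 : ℝ) Host.τfirst, ∀ x,
      ‖(fun t : ℝ => w (t + -1)) t x‖ ≤ 5 / 3 * TowerRates.wide.Y 1 - η - δ := fun t ht x =>
    hcap (t + -1) (hmem ht) x
  have hspeed' : ∃ x, ‖x‖ ≤ ρ ∧ TowerRates.wide.Y 1 + η + δ ≤ ‖(fun t : ℝ => w (t + -1)) Host.τfirst x‖ := by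
    show ∃ x, ‖x‖ ≤ ρ ∧ TowerRates.wide.Y 1 + η + δ ≤ ‖w (Host.τfirst + -1) x‖
    rw [hτ1]; exact hspeed
  have hstrain' : ∃ x₀ x₁, ‖x₀‖ ≤ ρ ∧ ‖x₁‖ ≤ ρ ∧
      (TowerRates.wide.A 1 + η) * ‖x₁ - x₀‖ + 2 * δ <
        ‖(fun t : ℝ => w (t + -1)) Host.τfirst x₁ - (fun t : ℝ => w (t + -1)) Host.τfirst x₀‖ := by
    show ∃ x₀ x₁, ‖x₀‖ ≤ ρ ∧ ‖x₁‖ ≤ ρ ∧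
      (TowerRates.wide.A 1 + η) * ‖x₁ - x₀‖ + 2 * δ < ‖w (Host.τfirst + -1) x₁ - w (Host.τfirst + -1) x₀‖
    rw [hτ1]; exact hstrain
  have hcore' : ∃ (x : EuclideanSpace ℝ (Fin 3)) (γ : ℝ → EuclideanSpace ℝ (Fin 3)),
      ‖x‖ ≤ ρ ∧ ContDiff ℝ 1 γ ∧ γ 0 = γ 1 ∧
      (∀ s ∈ Icc (0 : ℝ) 1, γ s ∈ closedBall x (1 / TowerRates.wide.N 1)) ∧
      (∀ s ∈ Icc (0 : ℝ) 1, ‖deriv γ s‖ ≤ 8 * Real.pi / TowerRates.wide.N 1) ∧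
      TowerRates.wide.N 1 ^ (TowerRates.wide.β - 2) + η + δ * (8 * Real.pi / TowerRates.wide.N 1) ≤
        circulation ((fun t : ℝ => w (t + -1)) Host.τfirst) γ := by
    show ∃ (x : EuclideanSpace ℝ (Fin 3)) (γ : ℝ → EuclideanSpace ℝ (Fin 3)),
      ‖x‖ ≤ ρ ∧ ContDiff ℝ 1 γ ∧ γ 0 = γ 1 ∧
      (∀ s ∈ Icc (0 : ℝ) 1, γ s ∈ closedBall x (1 / TowerRates.wide.N 1)) ∧
      (∀ s ∈ Icc (0 : ℝ) 1, ‖deriv γ s‖ ≤ 8 * Real.pi / TowerRates.wide.N 1) ∧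
      TowerRates.wide.N 1 ^ (TowerRates.wide.β - 2) + η + δ * (8 * Real.pi / TowerRates.wide.N 1) ≤
        circulation (w (Host.τfirst + -1)) γ
    rw [hτ1]; exact hcore
  exact palasekTowerBreakdown_episodeBase_of_lineGerm_nearFreeRun d hv hv1 hvE hnear hwc' hη hcap'
    hspeed' hstrain' hcore'

end Summit.NavierStokesRegularity.NavierStokesRegularity.Theorems

end
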